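import Mathlib
import Summits.Ventures.PercRepro2.Defs
import Summits.Ventures.PercRepro2.Independence
import Summits.Ventures.PercRepro2.Harris
import Summits.Ventures.PercRepro2.Graph
import Summits.Ventures.PercRepro2.Exploration
import Summits.Ventures.PercRepro2.Events
import Summits.Ventures.PercRepro2.FourFunctions
import Summits.Ventures.PercRepro2.Induced
import Summits.Ventures.PercRepro2.Frontier
import Summits.Ventures.PercRepro2.ObsIndependence
import Summits.Ventures.PercRepro2.BHK
import Summits.Ventures.PercRepro2.BHKEvents
import Summits.Ventures.PercRepro2.MultiSource
import Summits.Ventures.PercRepro2.OrderPreservation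
import Summits.Ventures.PercRepro2.SeedSet
import Summits.Ventures.PercRepro2.MultiSourceFun
import Summits.Ventures.PercRepro2.CrossRootT
import Summits.Ventures.PercRepro2.VdBKahn
import Summits.Ventures.PercRepro2.HullDefs
import Summits.Ventures.PercRepro2.CCTRootEdge

/-!
# Theorem PA-sub, part 1: objects, determination and independence (blind cell PercRepro2, typer-1; mine-c g3 `proofs/MINEC-THEOREMS.md` Theorem PA-sub,
INBOX 2026-08-23T11:03:51Z; lead g11 10:53:27Z queue)

Root `s`, avoided set `T`, targets `a, b`, an edge `e`. Write `ω⁺ = ω[e ↦ open]`, `ω⁻ = ω[e ↦ closed]`,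
`R⁺ = {ω ∣ s avoids T in ω⁺}`, `X⁻ = {ω ∣ s ↔ a in ω⁻}`, `Y⁻ = {ω ∣ s ↔ b in ω⁻}`. Then

**`paSub`**: `P(X⁻ ∩ R⁺) · P(Y⁻ ∩ R⁺) ≤ P(X⁻ ∩ Y⁻ ∩ R⁺) · P(R⁺)`.

`X⁻` is NOT a functional of the `e`-open cluster of `s` (it sees whether `a` is reachable WITHOUT `e`),
so this is not BHK on `G/e`. Proof (mine-c's T-frame): let `K = C_{ω⁺}(T)` be the `e`-open cluster of
the seed set `T`; on `R⁺` the vertex `s` lies outside `K`, and a path from `s` in `ω⁻` never enters `K`,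
so `X⁻ = X_W := {s ↔ a in ω⁻ with the edges at W deleted}` on `{K = W}` (`mem_X_iff_of_K`); `{K = W}` is
determined by the edges at `W` and `X_W` by the other edges (`dependsOn_Kset`, `dependsOn_delEvent`),
so they are independent; `X_W ∩ Y_W ≥ x̄(W)ȳ(W)` by Harris (`prob_mul_prob_le_prob_inter`); and the
decreasing functionals `x̄, ȳ` of `K` are positively correlated under the `e`-open measure by
`bhk_multi` for the seed set `T` avoiding `{s}` (with `1 − x̄`, `1 − ȳ`).
-/

namespace Summit.Ventures.PercRepro2

namespace PASub

open scoped Classical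

variable {V : Type*} {E : Type*} [Fintype E] [DecidableEq E] [Fintype V] [DecidableEq V]
  {R : Type*} [Field R] [LinearOrder R] [IsStrictOrderedRing R]

/-! ## The objects -/

section Objects

variable (ends : E → Sym2 V) (e : E) (s : V) (T : Finset V)

/-- The `e`-open cluster of the seed set `T`. -/
def Kset (ω : Config E) : Set V := clusterSet ends (Function.update ω e true) T

/-- `R⁺ = {s avoids T in ω⁺}`. -/
def Rplus : Set (Config E) := {ω | Function.update ω e true ∈ avoidAll ends s T}

/-- The `e`-closed connection event `{s ↔ a in ω⁻}`. -/
def Xminus (a : V) : Set (Config E) := {ω | Conn ends (Function.update ω e false) s a}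

/-- The `e`-closed connection with the edges at `W` deleted. -/
def Xdel (W : Set V) (a : V) : Set (Config E) :=
  {ω | Conn ends (delConfig ends W (Function.update ω e false)) s a}

omit [Fintype E] [DecidableEq V] [Fintype V] in
/-- `R⁺` is `{s ∉ K}`. -/
lemma mem_Rplus_iff (ω : Config E) : ω ∈ Rplus ends e s T ↔ s ∉ Kset ends e T ω := by
  simp only [Rplus, Set.mem_setOf_eq, avoidAll, Kset, mem_clusterSet, not_exists, not_and]
  constructor
  · intro h t ht hc
    exact h t ht (conn_symm hc)
  · intro h t ht hc
    exact h t ht (conn_symm hc)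

omit [Fintype E] [DecidableEq V] [Fintype V] in
/-- The `ω⁻`-cluster of `s` avoids `K` when `s ∉ K`. -/
lemma cluster_minus_subset_compl {ω : Config E} (hs : s ∉ Kset ends e T ω) :
    cluster ends (Function.update ω e false) s ⊆ (Kset ends e T ω)ᶜ := by
  intro x hx hxK
  apply hs
  obtain ⟨t, ht, htx⟩ := hxK
  exact ⟨t, ht, conn_trans htx (conn_symm (conn_mono (CCT.update_false_le_update_true' ω e) hx))⟩

omit [Fintype E] [DecidableEq E] [DecidableEq V] [Fintype V] in
/-- A connection from `s` whose cluster avoids `W` survives the deletion of the edges at `W`. -/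
lemma conn_delConfig_of_cluster_subset_compl {ω : Config E} {W : Set V} {x a : V}
    (hsub : cluster ends ω x ⊆ Wᶜ) (hc : Conn ends ω x a) :
    Conn ends (delConfig ends W ω) x a := by
  have hle : delConfig ends W ω ≤ ω := fun e' => by
    by_cases h : e' ∈ touches ends W
    · rw [delConfig_apply_of_mem h]; exact Bool.false_le _
    · rw [delConfig_apply_of_notMem h]
  -- the `delConfig`-cluster of `x` is closed under `ω`-adjacency (both ends avoid `W`)
  refine mem_of_conn_of_closed (ends := ends) (ω := ω)
    (S := cluster ends (delConfig ends W ω) x) ?_ (mem_cluster_self _ _ _) hc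
  intro u hu v huv
  obtain ⟨_, e', he', hends'⟩ := openGraph_adj.1 huv
  have hu' : u ∈ cluster ends ω x := cluster_mono hle x hu
  have hv' : v ∈ cluster ends ω x := Hull.mem_cluster_of_edge hu' he' hends'
  have hnot : e' ∉ touches ends W := by
    rintro ⟨y, hy, z, hyz⟩
    rw [hends', Sym2.eq_iff] at hyz
    rcases hyz with ⟨rfl, rfl⟩ | ⟨rfl, rfl⟩
    · exact hsub hu' hy
    · exact hsub hv' hy
  have he'' : delConfig ends W ω e' = true := by
    rw [delConfig_apply_of_notMem hnot]; exact he'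
  exact Hull.mem_cluster_of_edge hu he'' hends'

omit [Fintype E] [DecidableEq V] [Fintype V] in
/-- On `{K = W}` (with `s ∉ W`), the `e`-closed connection equals its `W`-deleted version. -/
lemma mem_X_iff_of_K {ω : Config E} {W : Set V} (hK : Kset ends e T ω = W) (hs : s ∉ W) (a : V) :
    ω ∈ Xminus ends e s a ↔ ω ∈ Xdel ends e s W a := by
  simp only [Xminus, Xdel, Set.mem_setOf_eq]
  constructor
  · intro hc
    have hsub : cluster ends (Function.update ω e false) s ⊆ Wᶜ := by
      rw [← hK]; exact cluster_minus_subset_compl ends e s T (hK ▸ hs)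
    exact conn_delConfig_of_cluster_subset_compl ends hsub hc
  · intro hc
    exact conn_mono (fun e' => by
      by_cases h : e' ∈ touches ends W
      · rw [delConfig_apply_of_mem h]; exact Bool.false_le _
      · rw [delConfig_apply_of_notMem h]) hc

end Objects

/-! ## Determination, independence, Harris -/

section Probability

variable (p : E → R) (ends : E → Sym2 V) (e : E) (s : V) (T : Finset V)

/-- The event `{K = W}`. -/
def KEvent (W : Set V) : Set (Config E) := {ω | Kset ends e T ω = W}

omit [Fintype E] [DecidableEq E] [DecidableEq V] [Fintype V] in
/-- The seed-set cluster is determined by the edges touching it. -/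
lemma clusterSet_eq_of_eqOn_touches {ω ω' : Config E} {W : Set V}
    (h : ∀ e' ∈ touches ends W, ω e' = ω' e') (hW : clusterSet ends ω T = W) :
    clusterSet ends ω' T = W := by
  have hcl : ∀ t ∈ T, cluster ends ω' t = cluster ends ω t := by
    intro t ht
    have hsub : cluster ends ω t ⊆ W := by
      intro x hx
      rw [← hW]
      exact ⟨t, ht, hx⟩
    exact cluster_eq_of_eqOn_touches (fun e' he' => h e' (touches_mono (ends := ends) hsub he')) rfl
  rw [← hW]
  ext x
  simp only [mem_clusterSet, ← mem_cluster]
  constructor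
  · rintro ⟨t, ht, hx⟩
    exact ⟨t, ht, (hcl t ht) ▸ hx⟩
  · rintro ⟨t, ht, hx⟩
    exact ⟨t, ht, (hcl t ht).symm ▸ hx⟩

omit [Fintype E] [DecidableEq V] [Fintype V] in
/-- `{K = W}` depends only on the edges touching `W`. -/
lemma dependsOn_KEvent (W : Set V) : DependsOn (· ∈ KEvent ends e T W) (touches ends W) := by
  intro ω ω' h
  have h' : ∀ e' ∈ touches ends W,
      Function.update ω e true e' = Function.update ω' e true e' := by
    intro e' he'
    by_cases hee : e' = e
    · subst hee; simp
    · rw [Function.update_of_ne hee, Function.update_of_ne hee]; exact h e' he'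
  exact propext ⟨fun hK => clusterSet_eq_of_eqOn_touches ends T h' hK,
    fun hK => clusterSet_eq_of_eqOn_touches ends T (fun e' he' => (h' e' he').symm) hK⟩

omit [Fintype E] [DecidableEq V] [Fintype V] in
/-- `X_W` depends only on the edges not touching `W`. -/
lemma dependsOn_Xdel (W : Set V) (a : V) :
    DependsOn (· ∈ Xdel ends e s W a) (touches ends W)ᶜ := by
  intro ω ω' h
  have h' : delConfig ends W (Function.update ω e false) =
      delConfig ends W (Function.update ω' e false) := by
    refine delConfig_congr fun e' he' => ?_
    by_cases hee : e' = e
    · subst hee; simp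
    · rw [Function.update_of_ne hee, Function.update_of_ne hee]; exact h e' he'
  show (Conn ends (delConfig ends W (Function.update ω e false)) s a) =
    (Conn ends (delConfig ends W (Function.update ω' e false)) s a)
  rw [h']

omit [Fintype E] [DecidableEq V] [Fintype V] in
/-- `X_W` is increasing. -/
lemma isUpperSet_Xdel (W : Set V) (a : V) : IsUpperSet (Xdel ends e s W a) := by
  intro ω ω' hle hω
  have hle' : delConfig ends W (Function.update ω e false) ≤
      delConfig ends W (Function.update ω' e false) := by
    intro e'
    by_cases h : e' ∈ touches ends W
    · rw [delConfig_apply_of_mem h]; exact Bool.false_le _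
    · rw [delConfig_apply_of_notMem h, delConfig_apply_of_notMem h]
      by_cases hee : e' = e
      · subst hee; simp
      · rw [Function.update_of_ne hee, Function.update_of_ne hee]; exact hle e'
  exact conn_mono hle' hω

omit [Fintype E] [DecidableEq V] [Fintype V] in
/-- `X_W` is antitone in `W`. -/
lemma Xdel_anti {W W' : Set V} (h : W ⊆ W') (a : V) : Xdel ends e s W' a ⊆ Xdel ends e s W a :=
  fun _ hω => conn_mono (delConfig_anti h _) hω

omit [Fintype V] [DecidableEq V] [LinearOrder R] [IsStrictOrderedRing R] in
/-- Independence of `X_W` from `{K = W}`. -/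
lemma prob_Xdel_inter_KEvent (W : Set V) (a : V) :
    prob p (Xdel ends e s W a ∩ KEvent ends e T W) =
      prob p (Xdel ends e s W a) * prob p (KEvent ends e T W) :=
  prob_inter_eq_mul_of_dependsOn p (F₁ := (touches ends W)ᶜ) (F₂ := touches ends W)
    disjoint_compl_left (dependsOn_Xdel ends e s W a) (dependsOn_KEvent ends e T W)

omit [Fintype V] [DecidableEq V] [LinearOrder R] [IsStrictOrderedRing R] in
/-- Independence of `X_W ∩ Y_W` from `{K = W}`. -/
lemma prob_Xdel_inter_Xdel_inter_KEvent (W : Set V) (a b : V) :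
    prob p (Xdel ends e s W a ∩ Xdel ends e s W b ∩ KEvent ends e T W) =
      prob p (Xdel ends e s W a ∩ Xdel ends e s W b) * prob p (KEvent ends e T W) := by
  have hd := dependsOn_inter (dependsOn_Xdel ends e s W a) (dependsOn_Xdel ends e s W b)
  rw [Set.union_self] at hd
  exact prob_inter_eq_mul_of_dependsOn p (F₁ := (touches ends W)ᶜ) (F₂ := touches ends W)
    disjoint_compl_left hd (dependsOn_KEvent ends e T W)

omit [DecidableEq V] [LinearOrder R] [IsStrictOrderedRing R] in
/-- The partition of `A ∩ R⁺` by the value of `K`. -/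
lemma prob_inter_Rplus_eq_sum (A : Set (Config E)) :
    prob p (A ∩ Rplus ends e s T) =
      ∑ W : Set V, if s ∉ W then prob p (A ∩ KEvent ends e T W) else 0 := by
  unfold prob
  have hmove : ∀ W : Set V,
      (if s ∉ W then ∑ ω, (A ∩ KEvent ends e T W).indicator (weight p) ω else 0) =
        ∑ ω, if s ∉ W then (A ∩ KEvent ends e T W).indicator (weight p) ω else 0 := by
    intro W
    split_ifs <;> simp
  simp_rw [hmove]
  rw [Finset.sum_comm]
  refine Finset.sum_congr rfl fun ω _ => ?_
  rw [Finset.sum_eq_single (Kset ends e T ω)]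
  · by_cases hs : s ∉ Kset ends e T ω
    · rw [if_pos hs]
      by_cases hA : ω ∈ A
      · have h1 : ω ∈ A ∩ Rplus ends e s T := ⟨hA, (mem_Rplus_iff ends e s T ω).2 hs⟩
        have h2 : ω ∈ A ∩ KEvent ends e T (Kset ends e T ω) := ⟨hA, rfl⟩
        rw [Set.indicator_of_mem h1, Set.indicator_of_mem h2]
      · have h1 : ω ∉ A ∩ Rplus ends e s T := fun h => hA h.1
        have h2 : ω ∉ A ∩ KEvent ends e T (Kset ends e T ω) := fun h => hA h.1
        rw [Set.indicator_of_notMem h1, Set.indicator_of_notMem h2]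
    · rw [if_neg hs, Set.indicator_of_notMem]
      intro h
      exact hs ((mem_Rplus_iff ends e s T ω).1 h.2)
  · intro W _ hW
    by_cases hs : s ∉ W
    · rw [if_pos hs, Set.indicator_of_notMem]
      intro h
      exact hW h.2.symm
    · rw [if_neg hs]
  · intro h
    exact absurd (Finset.mem_univ _) h

end Probability

end PASub

end Summit.Ventures.PercRepro2
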